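import Mathlib

/-!
# Riesz representation of an `L²`-bounded functional on a space of functions

Helper file for item stmt-AtomisticToContinuum-9144 (`ResponseDensity`, route
`OddSectorIrreversibility`, sub-problem `FouriersLaw` of `AtomisticToContinuum`): the purely
functional-analytic step producing the response DENSITY `h ∈ L²` from an `L²`-bounded linear
response FUNCTIONAL.

`exists_memLp_two_integral_mul_eq`: if `𝓒` is a linear space of square-integrable functions
`α → ℝ` and `D : 𝓒 → ℝ` is linear with `|D F| ≤ C (∫ F² dμ)^{1/2}`, then there is `h` with
`MemLp h 2 μ` and `D F = ∫ F·h dμ` for all `F ∈ 𝓒` (factor `D` through the image of `𝓒` in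
`L²(μ)`, extend by Hahn–Banach, represent by Riesz). No definitions.
-/

noncomputable section

open MeasureTheory
open scoped InnerProductSpace

namespace Summit.AtomisticToContinuum.FouriersLaw.Theorems

variable {α : Type*} [MeasurableSpace α] {μ : Measure α}

/-- The `L²(μ)` norm of `toLp F` is `(∫ F² dμ)^{1/2}`. -/
theorem norm_toLp_two_eq_sqrt {F : α → ℝ} (hF : MemLp F 2 μ) :
    ‖hF.toLp F‖ = Real.sqrt (∫ x, F x ^ 2 ∂μ) := by
  have hsq : ‖hF.toLp F‖ ^ 2 = ∫ x, F x ^ 2 ∂μ := by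
    rw [← real_inner_self_eq_norm_sq, MeasureTheory.L2.inner_def]
    refine integral_congr_ae ?_
    filter_upwards [hF.coeFn_toLp] with x hx
    rw [hx, real_inner_self_eq_norm_sq, Real.norm_eq_abs, sq_abs]
  rw [← hsq, Real.sqrt_sq (norm_nonneg _)]

/-- **Riesz representation of an `L²`-bounded functional.** Let `𝓒` be a linear space of
square-integrable functions and `D : 𝓒 → ℝ` linear with `|D F| ≤ C · (∫ F² dμ)^{1/2}`. Then
`D F = ∫ F h dμ` on `𝓒` for some `h ∈ L²(μ)`. -/
theorem exists_memLp_two_integral_mul_eq (𝓒 : Submodule ℝ (α → ℝ))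
    (hmem : ∀ F ∈ 𝓒, MemLp F 2 μ) (D : 𝓒 →ₗ[ℝ] ℝ) (C : ℝ)
    (hD : ∀ F : 𝓒, |D F| ≤ C * Real.sqrt (∫ x, (F : α → ℝ) x ^ 2 ∂μ)) :
    ∃ h : α → ℝ, MemLp h 2 μ ∧ ∀ F : 𝓒, D F = ∫ x, (F : α → ℝ) x * h x ∂μ := by
  -- the map `F ↦ [F] ∈ L²(μ)` as a linear map
  let ι : 𝓒 →ₗ[ℝ] Lp ℝ 2 μ :=
    { toFun := fun F => (hmem F F.2).toLp F
      map_add' := fun F G => by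
        rw [← MemLp.toLp_add (hmem F F.2) (hmem G G.2)]
        rfl
      map_smul' := fun c F => by
        simp only [RingHom.id_apply]
        rw [← MemLp.toLp_const_smul c (hmem F F.2)]
        rfl }
  have hιapp : ∀ F : 𝓒, ι F = (hmem F F.2).toLp F := fun F => rfl
  have hnorm : ∀ F : 𝓒, ‖ι F‖ = Real.sqrt (∫ x, (F : α → ℝ) x ^ 2 ∂μ) := fun F => by
    rw [hιapp]; exact norm_toLp_two_eq_sqrt (hmem F F.2)
  have hD' : ∀ F : 𝓒, |D F| ≤ C * ‖ι F‖ := fun F => by rw [hnorm]; exact hD F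
  -- `D` vanishes on the kernel of `ι`
  have hker : LinearMap.ker ι ≤ LinearMap.ker D := by
    intro F hF
    rw [LinearMap.mem_ker] at hF ⊢
    have h := hD' F
    rw [hF, norm_zero, mul_zero] at h
    exact abs_nonpos_iff.mp h
  -- factor `D` through the range of `ι`
  set D₁ : LinearMap.range ι →ₗ[ℝ] ℝ :=
    ((LinearMap.ker ι).liftQ D hker).comp ι.quotKerEquivRange.symm.toLinearMap with hD₁
  have hD₁ι : ∀ F : 𝓒, D₁ ⟨ι F, LinearMap.mem_range_self ι F⟩ = D F := by
    intro F
    simp only [hD₁, LinearMap.coe_comp, LinearEquiv.coe_coe, Function.comp_apply,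
      LinearMap.quotKerEquivRange_symm_apply_image, Submodule.mkQ_apply, Submodule.liftQ_apply]
  have hD₁bd : ∀ w : LinearMap.range ι, ‖D₁ w‖ ≤ C * ‖w‖ := by
    rintro ⟨w, hw⟩
    obtain ⟨F, rfl⟩ := LinearMap.mem_range.mp hw
    rw [hD₁ι F, Real.norm_eq_abs]
    exact hD' F
  set D₂ : LinearMap.range ι →L[ℝ] ℝ := D₁.mkContinuous C hD₁bd with hD₂
  -- Hahn–Banach extension to all of `L²(μ)`, then Riesz
  obtain ⟨g, hg, -⟩ := exists_extension_norm_eq (LinearMap.range ι) D₂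
  set hL : Lp ℝ 2 μ := (InnerProductSpace.toDual ℝ (Lp ℝ 2 μ)).symm g with hhL
  refine ⟨hL, Lp.memLp hL, fun F => ?_⟩
  have h1 : D F = g (ι F) := by
    rw [hg ⟨ι F, LinearMap.mem_range_self ι F⟩, hD₂, LinearMap.mkContinuous_apply, hD₁ι]
  have h2 : g (ι F) = ⟪hL, ι F⟫_ℝ := by
    rw [hhL, InnerProductSpace.toDual_symm_apply]
  rw [h1, h2, MeasureTheory.L2.inner_def]
  refine integral_congr_ae ?_
  filter_upwards [(hmem F F.2).coeFn_toLp] with x hx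
  have hx' : ((ι F : Lp ℝ 2 μ) : α → ℝ) x = (F : α → ℝ) x := hx
  rw [hx', Real.inner_apply, mul_comm]

end Summit.AtomisticToContinuum.FouriersLaw.Theorems

end
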